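import Literature.Topology.InvolutionOrbitSpace
import Literature.Topology.FourManifolds.BranchedDoubleModelLocal
import Mathlib.Geometry.Manifold.ContMDiff.Atlas
import Mathlib.Geometry.Manifold.ContMDiff.NormedSpace
import HarnessLib

/-!
# The orbit space of an involution with `σ`-adapted charts is a smooth `4`-manifold

Topic `Topology/FourManifolds`; namespace `Literature.Topology.FourManifolds.ConjQuotient`. The
ASSEMBLY step of the Arnold–Rokhlin smoothing (`ConjQuotientSmoothing.lean`), abstracted from
the complex-analytic input. Let `X` be a `C^∞` real manifold modelled on `ℂ² = Fin 2 → ℂ`,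
`σ` a continuous involution of `X`, and suppose given an ADAPTED ATLAS (`AdaptedAtlas σ`): a
family of charts `Φ` of the `C^∞` maximal atlas with `σ`-invariant sources on which `σ` reads
as `star` (coordinatewise conjugation), covering `X`, such that at every common REAL point of
two members the transition map descends through the branched double model
`B = branchedDoubleModel` to a `C^∞` germ of `ℝ⁴` (`descends`). Then:

* `quotientChart` — every adapted chart `Φ` descends to an open partial homeomorphism
  `ψ_Φ : X/σ ⇀ ℝ⁴`, `ψ_Φ (q y) = B (Φ y)`, with source `q(Φ.source)` (injective: the fibres of
  `B` are the conjugate pairs; continuous: descent of `B ∘ Φ`; open: `q` and `B` are open maps);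
* `contDiffAt_transition` — any two such charts are `C^∞`-compatible: at NON-REAL points the
  model `B` is a local diffeomorphism (`BranchedDoubleModelLocal.lean`) and the transition is
  `B ∘ Φ₂ ∘ Φ₁⁻¹ ∘ B⁻¹`; at REAL points it is the given descended germ;
* `AdaptedAtlas.chartedSpace`, `AdaptedAtlas.isManifold` — the orbit space `X/σ`
  (`Quotient s`, `s` the orbit setoid) is a `C^∞` `4`-manifold;
* `AdaptedAtlas.contMDiff_mk`, `AdaptedAtlas.isLocalDiffeomorphAt_mk`,
  `AdaptedAtlas.isBranchedDoubleQuotient` — the projection is `C^∞`, a local diffeomorphism off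
  `Fix σ`, and IS a branched double quotient in the sense of `IsBranchedDoubleQuotient`;
* `AdaptedAtlas.exists_isBranchedDoubleQuotient` — packaged existence statement (`X` compact,
  Hausdorff, second countable ⇒ so is `X/σ`).

The adapted atlas of an anti-holomorphic involution on a compact complex surface (tubular
charts at real points, translated holomorphic charts off the real locus) is supplied in
`ConjQuotientSmoothingProofs.lean`. Sources: Finashin (1996) §1 ¶2; Degtyarev–Kharlamov (2000)
§3.2; Bredon (1972) VI.2; all statements here are folklore.

## References

* [Finashin1996] S. Finashin, J. reine angew. Math. 481 (1996) = arXiv:dg-ga/9506007, §1 ¶2.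
* [DegtyarevKharlamov2000] A. Degtyarev, V. Kharlamov, Russian Math. Surveys 55 (2000), §3.2.
* [Bredon1972] G. E. Bredon, *Introduction to compact transformation groups* (1972), VI.2.
-/

noncomputable section

open scoped Manifold ContDiff Topology ComplexConjugate
open Set Function Filter
open Literature.Topology.InvolutionOrbitSpace

namespace Literature.Topology.FourManifolds

namespace ConjQuotient

universe u

variable {X : Type u} [TopologicalSpace X] {σ : X → X} {s : Setoid X}

/-! ### The descended charts -/

section Chart

variable {Φ : OpenPartialHomeomorph X (Fin 2 → ℂ)}

/-- `B ∘ Φ` is `σ`-invariant on the source of an adapted chart. [folklore] -/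
theorem model_apply_σ (hstar : ∀ y ∈ Φ.source, Φ (σ y) = star (Φ y)) {y : X}
    (hy : y ∈ Φ.source) : branchedDoubleModel (Φ (σ y)) = branchedDoubleModel (Φ y) := by
  rw [hstar y hy, branchedDoubleModel_star]

/-- The descended map `z ↦ B (Φ z.out)` on `q y`, `y ∈ Φ.source`, is `B (Φ y)`. [folklore] -/
theorem descend_mk (hs : ∀ x y, s x y ↔ y = x ∨ y = σ x)
    (hstar : ∀ y ∈ Φ.source, Φ (σ y) = star (Φ y)) {y : X} (hy : y ∈ Φ.source) :
    branchedDoubleModel (Φ (Quotient.mk s y).out) = branchedDoubleModel (Φ y) :=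
  liftOut_mk hs (g := fun y ↦ branchedDoubleModel (Φ y)) (fun _ h ↦ model_apply_σ hstar h) hy

/-- **The descended map is injective on `q(Φ.source)`**: the fibres of the model are the
conjugate pairs `{w, star w} = {Φ y, Φ (σ y)}`. [folklore] -/
theorem injOn_descend (hs : ∀ x y, s x y ↔ y = x ∨ y = σ x)
    (hmaps : MapsTo σ Φ.source Φ.source) (hstar : ∀ y ∈ Φ.source, Φ (σ y) = star (Φ y)) :
    InjOn (fun z : Quotient s ↦ branchedDoubleModel (Φ z.out)) (Quotient.mk s '' Φ.source) := by
  rintro _ ⟨y₁, hy₁, rfl⟩ _ ⟨y₂, hy₂, rfl⟩ h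
  simp only [descend_mk hs hstar hy₁, descend_mk hs hstar hy₂] at h
  rw [mk_eq_mk_iff hs]
  rcases (branchedDoubleModel_eq_iff _ _).1 h with h1 | h1
  · exact Or.inl (Φ.injOn hy₂ hy₁ h1)
  · right
    rw [← hstar y₁ hy₁] at h1
    exact Φ.injOn hy₂ (hmaps hy₁) h1

/-- The descended map is continuous on `q(Φ.source)`. [folklore] -/
theorem continuousOn_descend (hs : ∀ x y, s x y ↔ y = x ∨ y = σ x) (hσ : Involutive σ)
    (hσc : Continuous σ) (hstar : ∀ y ∈ Φ.source, Φ (σ y) = star (Φ y)) :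
    ContinuousOn (fun z : Quotient s ↦ branchedDoubleModel (Φ z.out))
      (Quotient.mk s '' Φ.source) :=
  continuousOn_liftOut hs hσ hσc Φ.open_source (g := fun y ↦ branchedDoubleModel (Φ y))
    (continuous_branchedDoubleModel.comp_continuousOn Φ.continuousOn)
    fun _ h ↦ model_apply_σ hstar h

/-- The image of `q(Φ.source) ∩ O'` under the descended map is `B(Φ(Φ.source ∩ q⁻¹ O'))`.
[folklore] -/
theorem image_descend_inter (hs : ∀ x y, s x y ↔ y = x ∨ y = σ x)
    (hmaps : MapsTo σ Φ.source Φ.source) (hstar : ∀ y ∈ Φ.source, Φ (σ y) = star (Φ y))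
    (O' : Set (Quotient s)) :
    (fun z : Quotient s ↦ branchedDoubleModel (Φ z.out)) '' (Quotient.mk s '' Φ.source ∩ O') =
      branchedDoubleModel '' (Φ '' (Φ.source ∩ Quotient.mk s ⁻¹' O')) := by
  ext v
  constructor
  · rintro ⟨z, ⟨hz, hzO⟩, rfl⟩
    have hout : z.out ∈ Φ.source := out_mem_of_mem_image hs hmaps hz
    exact ⟨Φ z.out, ⟨z.out, ⟨hout, by simp [hzO]⟩, rfl⟩, rfl⟩
  · rintro ⟨_, ⟨y, ⟨hy, hyO⟩, rfl⟩, rfl⟩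
    exact ⟨Quotient.mk s y, ⟨mem_image_of_mem _ hy, hyO⟩, descend_mk hs hstar hy⟩

/-- The restriction of the descended map to `q(Φ.source)` is an open map. [folklore] -/
theorem isOpenMap_restrict_descend (hs : ∀ x y, s x y ↔ y = x ∨ y = σ x)
    (hmaps : MapsTo σ Φ.source Φ.source) (hstar : ∀ y ∈ Φ.source, Φ (σ y) = star (Φ y)) :
    IsOpenMap ((Quotient.mk s '' Φ.source).restrict
      fun z : Quotient s ↦ branchedDoubleModel (Φ z.out)) := by
  intro O hO
  obtain ⟨O', hO', rfl⟩ := isOpen_induced_iff.1 hO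
  rw [restrict_eq, image_comp, Subtype.image_preimage_coe, image_descend_inter hs hmaps hstar]
  exact isOpen_image_branchedDoubleModel (Φ.isOpen_image_of_subset_source
    (Φ.open_source.inter (hO'.preimage continuous_quotient_mk')) inter_subset_left)

/-- The partial equivalence underlying the descended chart: `z ↦ B (Φ z.out)` on
`q(Φ.source)`, inverse `v ↦ q (Φ⁻¹ w)` for any `w ∈ Φ.target` with `B w = v`. [folklore] -/
def quotientPartialEquiv (hs : ∀ x y, s x y ↔ y = x ∨ y = σ x) (hσ : Involutive σ)
    (Φ : OpenPartialHomeomorph X (Fin 2 → ℂ))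
    (hmaps : MapsTo σ Φ.source Φ.source) (hstar : ∀ y ∈ Φ.source, Φ (σ y) = star (Φ y)) :
    PartialEquiv (Quotient s) (EuclideanSpace ℝ (Fin 4)) where
  toFun z := branchedDoubleModel (Φ z.out)
  invFun v := Quotient.mk s (Φ.symm (invFunOn branchedDoubleModel Φ.target v))
  source := Quotient.mk s '' Φ.source
  target := branchedDoubleModel '' Φ.target
  map_source' := by
    intro z hz
    exact mem_image_of_mem _ (Φ.map_source (out_mem_of_mem_image hs hmaps hz))
  map_target' := by
    intro v hv
    exact mem_image_of_mem _ (Φ.map_target (invFunOn_mem hv))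
  left_inv' := by
    rintro _ ⟨y, hy, rfl⟩
    have hmem : branchedDoubleModel (Φ (Quotient.mk s y).out) ∈ branchedDoubleModel '' Φ.target := by
      rw [descend_mk hs hstar hy]
      exact mem_image_of_mem _ (Φ.map_source hy)
    set w := invFunOn branchedDoubleModel Φ.target (branchedDoubleModel (Φ (Quotient.mk s y).out))
      with hw
    have hwt : w ∈ Φ.target := invFunOn_mem hmem
    have hBw : branchedDoubleModel w = branchedDoubleModel (Φ y) := by
      rw [hw, invFunOn_eq hmem, descend_mk hs hstar hy]
    show Quotient.mk s (Φ.symm w) = Quotient.mk s y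
    rw [mk_eq_mk_iff hs]
    rcases (branchedDoubleModel_eq_iff _ _).1 hBw.symm with h1 | h1
    · left
      rw [h1, Φ.left_inv hy]
    · right
      rw [h1, ← hstar y hy, Φ.left_inv (hmaps hy), hσ y]
  right_inv' := by
    intro v hv
    set w := invFunOn branchedDoubleModel Φ.target v with hw
    have hwt : w ∈ Φ.target := invFunOn_mem hv
    show branchedDoubleModel (Φ (Quotient.mk s (Φ.symm w)).out) = v
    rw [descend_mk hs hstar (Φ.map_target hwt), Φ.right_inv hwt, hw, invFunOn_eq hv]

/-- **The descended chart** `ψ_Φ : X/σ ⇀ ℝ⁴` of a `σ`-adapted chart `Φ` (`σ`-invariant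
source, `Φ ∘ σ = star ∘ Φ`): source `q(Φ.source)`, target `B(Φ.target)`, `ψ_Φ (q y) = B (Φ y)`.
[folklore] -/
def quotientChart (hs : ∀ x y, s x y ↔ y = x ∨ y = σ x) (hσ : Involutive σ)
    (hσc : Continuous σ) (Φ : OpenPartialHomeomorph X (Fin 2 → ℂ))
    (hmaps : MapsTo σ Φ.source Φ.source) (hstar : ∀ y ∈ Φ.source, Φ (σ y) = star (Φ y)) :
    OpenPartialHomeomorph (Quotient s) (EuclideanSpace ℝ (Fin 4)) :=
  OpenPartialHomeomorph.ofContinuousOpenRestrict (quotientPartialEquiv hs hσ Φ hmaps hstar)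
    (continuousOn_descend hs hσ hσc hstar) (isOpenMap_restrict_descend hs hmaps hstar)
    (isOpen_image_mk hs hσ hσc Φ.open_source)

variable {hs : ∀ x y, s x y ↔ y = x ∨ y = σ x} {hσ : Involutive σ} {hσc : Continuous σ}
  {hmaps : MapsTo σ Φ.source Φ.source} {hstar : ∀ y ∈ Φ.source, Φ (σ y) = star (Φ y)}

/-- The descended chart as a function. [folklore] -/
theorem quotientChart_coe :
    (quotientChart hs hσ hσc Φ hmaps hstar : Quotient s → EuclideanSpace ℝ (Fin 4)) =
      fun z ↦ branchedDoubleModel (Φ z.out) := rfl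

/-- The source of the descended chart is `q(Φ.source)`. [folklore] -/
theorem quotientChart_source :
    (quotientChart hs hσ hσc Φ hmaps hstar).source = Quotient.mk s '' Φ.source := rfl

/-- The target of the descended chart is `B(Φ.target)`. [folklore] -/
theorem quotientChart_target :
    (quotientChart hs hσ hσc Φ hmaps hstar).target = branchedDoubleModel '' Φ.target := rfl

/-- `ψ_Φ (q y) = B (Φ y)` for `y ∈ Φ.source`. [folklore] -/
theorem quotientChart_apply_mk {y : X} (hy : y ∈ Φ.source) :
    quotientChart hs hσ hσc Φ hmaps hstar (Quotient.mk s y) = branchedDoubleModel (Φ y) :=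
  descend_mk hs hstar hy

/-- `q y ∈ ψ_Φ.source` for `y ∈ Φ.source`. [folklore] -/
theorem mk_mem_quotientChart_source {y : X} (hy : y ∈ Φ.source) :
    Quotient.mk s y ∈ (quotientChart hs hσ hσc Φ hmaps hstar).source :=
  mem_image_of_mem _ hy

/-- `ψ_Φ.symm (B (Φ y)) = q y` for `y ∈ Φ.source`. [folklore] -/
theorem quotientChart_symm_apply {y : X} (hy : y ∈ Φ.source) :
    (quotientChart hs hσ hσc Φ hmaps hstar).symm (branchedDoubleModel (Φ y)) =
      Quotient.mk s y := by
  rw [← quotientChart_apply_mk (hs := hs) (hσ := hσ) (hσc := hσc) (hmaps := hmaps)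
    (hstar := hstar) hy]
  exact (quotientChart hs hσ hσc Φ hmaps hstar).left_inv (mk_mem_quotientChart_source hy)

/-- Points of the source of `ψ_Φ` are `q y` with `y ∈ Φ.source`, and then `y`, `σ y` are both
in the source. [folklore] -/
theorem mem_source_of_mk_mem {y : X}
    (hy : Quotient.mk s y ∈ (quotientChart hs hσ hσc Φ hmaps hstar).source) : y ∈ Φ.source := by
  rw [quotientChart_source, ← mem_preimage, preimage_image_mk hs] at hy
  rcases hy with hy | ⟨x, hx, hxy⟩
  · exact hy
  · rw [← hxy]; exact hmaps hx

end Chart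

/-! ### Compatibility of two descended charts -/

section Compat

variable [ChartedSpace (Fin 2 → ℂ) X]
  {hs : ∀ x y, s x y ↔ y = x ∨ y = σ x} {hσ : Involutive σ} {hσc : Continuous σ}
  {Φ₁ Φ₂ : OpenPartialHomeomorph X (Fin 2 → ℂ)}
  {hm₁ : MapsTo σ Φ₁.source Φ₁.source} {hst₁ : ∀ y ∈ Φ₁.source, Φ₁ (σ y) = star (Φ₁ y)}
  {hm₂ : MapsTo σ Φ₂.source Φ₂.source} {hst₂ : ∀ y ∈ Φ₂.source, Φ₂ (σ y) = star (Φ₂ y)}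

/-- **Compatibility of descended charts.** Let `Φ₁`, `Φ₂` be `σ`-adapted charts of the `C^∞`
maximal atlas of `X`, and suppose that at every common real point `y` the transition descends:
there is `T`, `C^∞` at `B (Φ₁ y)`, with `B (Φ₂ y') = T (B (Φ₁ y'))` for `y'` near `y`. Then
`ψ_{Φ₂} ∘ ψ_{Φ₁}⁻¹` is `C^∞` at every point of its source. At a non-real point the model is
a local diffeomorphism and the transition is `B ∘ Φ₂ ∘ Φ₁⁻¹ ∘ B⁻¹`. [folklore] -/
theorem contDiffAt_transition [IsManifold 𝓘(ℝ, Fin 2 → ℂ) ∞ X]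
    (h₁ : Φ₁ ∈ IsManifold.maximalAtlas 𝓘(ℝ, Fin 2 → ℂ) ∞ X)
    (h₂ : Φ₂ ∈ IsManifold.maximalAtlas 𝓘(ℝ, Fin 2 → ℂ) ∞ X)
    (hT : ∀ y ∈ Φ₁.source ∩ Φ₂.source, σ y = y →
      ∃ T : EuclideanSpace ℝ (Fin 4) → EuclideanSpace ℝ (Fin 4),
        ContDiffAt ℝ ∞ T (branchedDoubleModel (Φ₁ y)) ∧
        ∀ᶠ y' in 𝓝 y, branchedDoubleModel (Φ₂ y') = T (branchedDoubleModel (Φ₁ y')))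
    {v : EuclideanSpace ℝ (Fin 4)}
    (hv : v ∈ ((quotientChart hs hσ hσc Φ₁ hm₁ hst₁).symm.trans
      (quotientChart hs hσ hσc Φ₂ hm₂ hst₂)).source) :
    ContDiffAt ℝ ∞ ((quotientChart hs hσ hσc Φ₂ hm₂ hst₂) ∘
      (quotientChart hs hσ hσc Φ₁ hm₁ hst₁).symm) v := by
  set ψ₁ := quotientChart hs hσ hσc Φ₁ hm₁ hst₁ with hψ₁
  set ψ₂ := quotientChart hs hσ hσc Φ₂ hm₂ hst₂ with hψ₂
  rw [OpenPartialHomeomorph.trans_source, OpenPartialHomeomorph.symm_source] at hv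
  obtain ⟨hv₁, hv₂⟩ := hv
  -- `v = B (Φ₁ y)` with `y ∈ Φ₁.source ∩ Φ₂.source`
  rw [quotientChart_target] at hv₁
  obtain ⟨w, hw, rfl⟩ := hv₁
  set y := Φ₁.symm w with hy_def
  have hy₁ : y ∈ Φ₁.source := Φ₁.map_target hw
  have hwy : Φ₁ y = w := Φ₁.right_inv hw
  rw [← hwy] at hv₂ ⊢
  rw [mem_preimage, quotientChart_symm_apply hy₁] at hv₂
  have hy₂ : y ∈ Φ₂.source := mem_source_of_mk_mem hv₂
  by_cases hfix : σ y = y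
  · -- real point: the given descended germ
    obtain ⟨T, hT, hev⟩ := hT y ⟨hy₁, hy₂⟩ hfix
    obtain ⟨O₀, hO₀, hO₀o, hyO₀⟩ := eventually_nhds_iff.1 hev
    set O : Set X := O₀ ∩ σ ⁻¹' O₀ ∩ (Φ₁.source ∩ Φ₂.source) with hO
    have hOo : IsOpen O :=
      (hO₀o.inter (hO₀o.preimage hσc)).inter (Φ₁.open_source.inter Φ₂.open_source)
    have hyO : y ∈ O := ⟨⟨hyO₀, by rw [mem_preimage, hfix]; exact hyO₀⟩, hy₁, hy₂⟩
    -- the neighbourhood `B (Φ₁ '' O)` of `v`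
    have hG : branchedDoubleModel '' (Φ₁ '' O) ∈ 𝓝 (branchedDoubleModel (Φ₁ y)) :=
      (isOpen_image_branchedDoubleModel (Φ₁.isOpen_image_of_subset_source hOo
        fun x hx ↦ hx.2.1)).mem_nhds (mem_image_of_mem _ (mem_image_of_mem _ hyO))
    refine hT.congr_of_eventuallyEq ?_
    filter_upwards [hG]
    rintro _ ⟨_, ⟨y', hy', rfl⟩, rfl⟩
    simp only [comp_apply, hψ₁, hψ₂]
    rw [quotientChart_symm_apply hy'.2.1, quotientChart_apply_mk hy'.2.2]
    exact hO₀ y' hy'.1.1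
  · -- non-real point: `B` is a local diffeomorphism at `Φ₁ y`
    have hne : star (Φ₁ y) ≠ Φ₁ y := by
      intro h
      apply hfix
      exact Φ₁.injOn (hm₁ hy₁) hy₁ (by rw [hst₁ y hy₁, h])
    obtain ⟨β, hyβ, hβB, hβ, hβ'⟩ := exists_localInverse_branchedDoubleModel hne
    -- the neighbourhood `β (β.source ∩ Φ₁ '' (Φ₁.source ∩ Φ₂.source))`
    set S : Set (Fin 2 → ℂ) := β.source ∩ Φ₁ '' (Φ₁.source ∩ Φ₂.source) with hS
    have hSo : IsOpen S := β.open_source.inter (Φ₁.isOpen_image_of_subset_source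
      (Φ₁.open_source.inter Φ₂.open_source) inter_subset_left)
    have hyS : Φ₁ y ∈ S := ⟨hyβ, mem_image_of_mem _ ⟨hy₁, hy₂⟩⟩
    have hG : β '' S ∈ 𝓝 (branchedDoubleModel (Φ₁ y)) := by
      rw [← hβB _ hyβ]
      exact (β.isOpen_image_of_subset_source hSo inter_subset_left).mem_nhds
        (mem_image_of_mem _ hyS)
    -- the smooth model `B ∘ Φ₂ ∘ Φ₁⁻¹ ∘ β⁻¹`
    have hF : ContDiffAt ℝ ∞
        (fun v' ↦ branchedDoubleModel (Φ₂ (Φ₁.symm (β.symm v')))) (branchedDoubleModel (Φ₁ y)) := by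
      have hβs : ContDiffAt ℝ ∞ β.symm (branchedDoubleModel (Φ₁ y)) := by
        refine hβ'.contDiffAt (β.open_target.mem_nhds ?_)
        rw [← hβB _ hyβ]; exact β.map_source hyβ
      have htrans : ContDiffAt ℝ ∞ (fun w' ↦ Φ₂ (Φ₁.symm w')) (β.symm (branchedDoubleModel (Φ₁ y))) := by
        have hpt : β.symm (branchedDoubleModel (Φ₁ y)) = Φ₁ y := by
          rw [← hβB _ hyβ]; exact β.left_inv hyβ
        rw [hpt]
        have hset : IsOpen (Φ₁.target ∩ Φ₁.symm ⁻¹' Φ₂.source) :=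
          Φ₁.continuousOn_symm.isOpen_inter_preimage Φ₁.open_target Φ₂.open_source
        have hmem : Φ₁ y ∈ Φ₁.target ∩ Φ₁.symm ⁻¹' Φ₂.source :=
          ⟨Φ₁.map_source hy₁, by rw [mem_preimage, Φ₁.left_inv hy₁]; exact hy₂⟩
        have h1 : ContMDiffOn 𝓘(ℝ, Fin 2 → ℂ) 𝓘(ℝ, Fin 2 → ℂ) ∞ (fun w' ↦ Φ₂ (Φ₁.symm w'))
            (Φ₁.target ∩ Φ₁.symm ⁻¹' Φ₂.source) :=
          (contMDiffOn_of_mem_maximalAtlas h₂).comp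
            ((contMDiffOn_symm_of_mem_maximalAtlas h₁).mono inter_subset_left)
            fun w' hw' ↦ hw'.2
        exact (contMDiffOn_iff_contDiffOn.1 h1).contDiffAt (hset.mem_nhds hmem)
      exact contDiff_branchedDoubleModel.contDiffAt.comp _ (htrans.comp _ hβs)
    refine hF.congr_of_eventuallyEq ?_
    filter_upwards [hG]
    rintro _ ⟨w', ⟨hw'β, ⟨y', hy', rfl⟩⟩, rfl⟩
    rw [β.left_inv hw'β, Φ₁.left_inv hy'.1]
    simp only [comp_apply, hψ₁, hψ₂]
    rw [hβB _ hw'β, quotientChart_symm_apply hy'.1, quotientChart_apply_mk hy'.2]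

/-- `C^∞` compatibility on the whole source of the transition. [folklore] -/
theorem contDiffOn_transition [IsManifold 𝓘(ℝ, Fin 2 → ℂ) ∞ X]
    (h₁ : Φ₁ ∈ IsManifold.maximalAtlas 𝓘(ℝ, Fin 2 → ℂ) ∞ X)
    (h₂ : Φ₂ ∈ IsManifold.maximalAtlas 𝓘(ℝ, Fin 2 → ℂ) ∞ X)
    (hT : ∀ y ∈ Φ₁.source ∩ Φ₂.source, σ y = y →
      ∃ T : EuclideanSpace ℝ (Fin 4) → EuclideanSpace ℝ (Fin 4),
        ContDiffAt ℝ ∞ T (branchedDoubleModel (Φ₁ y)) ∧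
        ∀ᶠ y' in 𝓝 y, branchedDoubleModel (Φ₂ y') = T (branchedDoubleModel (Φ₁ y'))) :
    ContDiffOn ℝ ∞ ((quotientChart hs hσ hσc Φ₂ hm₂ hst₂) ∘
        (quotientChart hs hσ hσc Φ₁ hm₁ hst₁).symm)
      ((quotientChart hs hσ hσc Φ₁ hm₁ hst₁).symm.trans
        (quotientChart hs hσ hσc Φ₂ hm₂ hst₂)).source :=
  fun _ hv ↦ (contDiffAt_transition h₁ h₂ hT hv).contDiffWithinAt

end Compat

/-! ### Adapted atlases and the manifold structure on the orbit space -/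

section Atlas

variable [ChartedSpace (Fin 2 → ℂ) X]

variable (σ) in
/-- An **adapted atlas** for the continuous involution `σ` of the `C^∞` manifold `X` (charts
in `ℂ²`): a family of charts of the `C^∞` maximal atlas with `σ`-invariant sources on which
`σ` reads as coordinatewise conjugation, covering `X`, whose transition maps descend through
the branched double model to `C^∞` germs at every common real point. [folklore] -/
structure AdaptedAtlas where
  /-- the adapted charts -/
  charts : Set (OpenPartialHomeomorph X (Fin 2 → ℂ))
  /-- they belong to the `C^∞` maximal atlas -/
  mem_maximalAtlas : ∀ Φ ∈ charts, Φ ∈ IsManifold.maximalAtlas 𝓘(ℝ, Fin 2 → ℂ) ∞ X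
  /-- their sources are `σ`-invariant -/
  mapsTo : ∀ Φ ∈ charts, MapsTo σ Φ.source Φ.source
  /-- `σ` reads as `star` -/
  adapted : ∀ Φ ∈ charts, ∀ y ∈ Φ.source, Φ (σ y) = star (Φ y)
  /-- the sources cover `X` -/
  covers : ∀ x, ∃ Φ ∈ charts, x ∈ Φ.source
  /-- at common real points the transition maps descend through the model -/
  descends : ∀ Φ₁ ∈ charts, ∀ Φ₂ ∈ charts, ∀ y ∈ Φ₁.source ∩ Φ₂.source, σ y = y →
    ∃ T : EuclideanSpace ℝ (Fin 4) → EuclideanSpace ℝ (Fin 4),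
      ContDiffAt ℝ ∞ T (branchedDoubleModel (Φ₁ y)) ∧
      ∀ᶠ y' in 𝓝 y, branchedDoubleModel (Φ₂ y') = T (branchedDoubleModel (Φ₁ y'))

namespace AdaptedAtlas

variable (A : AdaptedAtlas σ) (hs : ∀ x y, s x y ↔ y = x ∨ y = σ x)
  (hσ : Involutive σ) (hσc : Continuous σ)

/-- A chart of the atlas containing `x`. [folklore] -/
def chartOf (x : X) : OpenPartialHomeomorph X (Fin 2 → ℂ) := (A.covers x).choose

/-- `chartOf x` is a member of the atlas. [folklore] -/
theorem chartOf_mem (x : X) : A.chartOf x ∈ A.charts := (A.covers x).choose_spec.1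

/-- `x ∈ (chartOf x).source`. [folklore] -/
theorem mem_chartOf_source (x : X) : x ∈ (A.chartOf x).source := (A.covers x).choose_spec.2

/-- The descended chart of a member of the atlas. [folklore] -/
def qchart {Φ : OpenPartialHomeomorph X (Fin 2 → ℂ)} (hΦ : Φ ∈ A.charts) :
    OpenPartialHomeomorph (Quotient s) (EuclideanSpace ℝ (Fin 4)) :=
  quotientChart hs hσ hσc Φ (A.mapsTo Φ hΦ) (A.adapted Φ hΦ)

/-- **The charted space structure on `X/σ`**: the atlas of descended charts `ψ_Φ`,
`Φ ∈ A.charts`; the chart at `z` is `ψ_Φ` for the chosen `Φ ∋ z.out`. [folklore] -/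
@[reducible] def chartedSpace : ChartedSpace (EuclideanSpace ℝ (Fin 4)) (Quotient s) where
  atlas := {ψ | ∃ (Φ : OpenPartialHomeomorph X (Fin 2 → ℂ)) (hΦ : Φ ∈ A.charts),
    ψ = A.qchart hs hσ hσc hΦ}
  chartAt z := A.qchart hs hσ hσc (A.chartOf_mem z.out)
  mem_chart_source z := by
    have h : Quotient.mk s z.out ∈ (A.qchart hs hσ hσc (A.chartOf_mem z.out)).source :=
      mk_mem_quotientChart_source (A.mem_chartOf_source z.out)
    rwa [Quotient.out_eq] at h
  chart_mem_atlas z := ⟨A.chartOf z.out, A.chartOf_mem z.out, rfl⟩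

/-- **`X/σ` is a `C^∞` `4`-manifold** for the charted space structure of an adapted atlas
(`contDiffOn_transition`). [folklore] -/
theorem isManifold [IsManifold 𝓘(ℝ, Fin 2 → ℂ) ∞ X] :
    letI := A.chartedSpace hs hσ hσc
    IsManifold (𝓡 4) ∞ (Quotient s) := by
  letI := A.chartedSpace hs hσ hσc
  refine isManifold_of_contDiffOn (𝓡 4) ∞ (Quotient s) fun e e' he he' ↦ ?_
  obtain ⟨Φ₁, hΦ₁, rfl⟩ := he
  obtain ⟨Φ₂, hΦ₂, rfl⟩ := he'
  simp only [modelWithCornersSelf_coe, modelWithCornersSelf_coe_symm, CompTriple.comp_eq,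
    range_id, inter_univ, preimage_id_eq, id_eq, OpenPartialHomeomorph.coe_trans]
  exact contDiffOn_transition (A.mem_maximalAtlas Φ₁ hΦ₁) (A.mem_maximalAtlas Φ₂ hΦ₂)
    (A.descends Φ₁ hΦ₁ Φ₂ hΦ₂)

/-- **The projection `X → X/σ` is `C^∞`**: in the charts `Φ`, `ψ_Φ` it is the model `B`.
[folklore] -/
theorem contMDiff_mk [IsManifold 𝓘(ℝ, Fin 2 → ℂ) ∞ X] :
    letI := A.chartedSpace hs hσ hσc
    ContMDiff 𝓘(ℝ, Fin 2 → ℂ) (𝓡 4) ∞ (Quotient.mk s) := by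
  letI := A.chartedSpace hs hσ hσc
  haveI := A.isManifold hs hσ hσc
  intro y
  obtain ⟨Φ, hΦ, hy⟩ := A.covers y
  have he : Φ ∈ IsManifold.maximalAtlas 𝓘(ℝ, Fin 2 → ℂ) ∞ X := A.mem_maximalAtlas Φ hΦ
  have he' : A.qchart hs hσ hσc hΦ ∈ IsManifold.maximalAtlas (𝓡 4) ∞ (Quotient s) :=
    IsManifold.subset_maximalAtlas ⟨Φ, hΦ, rfl⟩
  have hqy : Quotient.mk s y ∈ (A.qchart hs hσ hσc hΦ).source := mk_mem_quotientChart_source hy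
  rw [contMDiffAt_iff_of_mem_maximalAtlas he he' hy hqy]
  refine ⟨continuous_quotient_mk'.continuousAt, ?_⟩
  simp only [OpenPartialHomeomorph.extend, modelWithCornersSelf_partialEquiv,
    PartialEquiv.trans_refl, ModelWithCorners.range_eq_univ, contDiffWithinAt_univ,
    OpenPartialHomeomorph.toFun_eq_coe]
  refine (contDiff_branchedDoubleModel.contDiffAt (x := Φ y)).congr_of_eventuallyEq ?_
  filter_upwards [Φ.open_target.mem_nhds (Φ.map_source hy)] with w hw
  simp only [comp_apply, OpenPartialHomeomorph.coe_toPartialEquiv_symm]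
  show A.qchart hs hσ hσc hΦ (Quotient.mk s (Φ.symm w)) = branchedDoubleModel w
  rw [qchart, quotientChart_apply_mk (Φ.map_target hw), Φ.right_inv hw]

/-- **Off the real locus the projection is a local diffeomorphism**: near a non-fixed `y` it
factors as `ψ_Φ⁻¹ ∘ β ∘ Φ` with `β` a smooth local inverse of the model at the non-real point
`Φ y`. [folklore] -/
theorem isLocalDiffeomorphAt_mk [IsManifold 𝓘(ℝ, Fin 2 → ℂ) ∞ X] {y : X} (hy : σ y ≠ y) :
    letI := A.chartedSpace hs hσ hσc
    IsLocalDiffeomorphAt 𝓘(ℝ, Fin 2 → ℂ) (𝓡 4) ∞ (Quotient.mk s) y := by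
  letI := A.chartedSpace hs hσ hσc
  haveI := A.isManifold hs hσ hσc
  obtain ⟨Φ, hΦ, hyΦ⟩ := A.covers y
  set ψ := A.qchart hs hσ hσc hΦ with hψ
  have hm := A.mapsTo Φ hΦ
  have hst := A.adapted Φ hΦ
  have hne : star (Φ y) ≠ Φ y := by
    intro h
    exact hy (Φ.injOn (hm hyΦ) hyΦ (by rw [hst y hyΦ, h]))
  obtain ⟨β, hyβ, hβB, hβ, hβ'⟩ := exists_localInverse_branchedDoubleModel hne
  -- the partial homeomorphism `E = ψ⁻¹ ∘ β ∘ Φ`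
  set E : OpenPartialHomeomorph X (Quotient s) := (Φ ≫ₕ β) ≫ₕ ψ.symm with hE
  have hEq : ∀ x ∈ E.source, E x = Quotient.mk s x := by
    intro x hx
    rw [hE, OpenPartialHomeomorph.trans_source, OpenPartialHomeomorph.trans_source] at hx
    simp only [hE, OpenPartialHomeomorph.coe_trans, comp_apply]
    rw [hβB _ hx.1.2, hψ, qchart, quotientChart_symm_apply hx.1.1]
  have hyE : y ∈ E.source := by
    rw [hE, OpenPartialHomeomorph.trans_source, OpenPartialHomeomorph.trans_source]
    refine ⟨⟨hyΦ, hyβ⟩, ?_⟩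
    simp only [mem_preimage, OpenPartialHomeomorph.coe_trans, comp_apply,
      OpenPartialHomeomorph.symm_source]
    rw [hβB _ hyβ, hψ, qchart, ← quotientChart_apply_mk (hs := hs) (hσ := hσ) (hσc := hσc)
      (hmaps := hm) (hstar := hst) hyΦ]
    exact OpenPartialHomeomorph.map_source _ (mk_mem_quotientChart_source hyΦ)
  have hq : ContMDiff 𝓘(ℝ, Fin 2 → ℂ) (𝓡 4) ∞ (Quotient.mk s) := A.contMDiff_mk hs hσ hσc
  have hEsmooth : ContMDiffOn 𝓘(ℝ, Fin 2 → ℂ) (𝓡 4) ∞ E E.source :=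
    hq.contMDiffOn.congr hEq
  have hψmax : ψ ∈ IsManifold.maximalAtlas (𝓡 4) ∞ (Quotient s) :=
    IsManifold.subset_maximalAtlas ⟨Φ, hΦ, rfl⟩
  have hΦmax := A.mem_maximalAtlas Φ hΦ
  have hEsymm : ContMDiffOn (𝓡 4) 𝓘(ℝ, Fin 2 → ℂ) ∞ E.symm E.target := by
    -- `E.symm = Φ.symm ∘ β.symm ∘ ψ` on `E.target`
    have htgt : ∀ z ∈ E.target, z ∈ ψ.source ∧ ψ z ∈ β.target ∧ β.symm (ψ z) ∈ Φ.target := by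
      intro z hz
      rw [hE, OpenPartialHomeomorph.trans_target, OpenPartialHomeomorph.symm_target,
        mem_inter_iff, mem_preimage, OpenPartialHomeomorph.symm_symm,
        OpenPartialHomeomorph.trans_target, mem_inter_iff, mem_preimage] at hz
      exact ⟨hz.1, hz.2.1, hz.2.2⟩
    have h1 : ContMDiffOn (𝓡 4) (𝓡 4) ∞ ψ E.target :=
      (contMDiffOn_of_mem_maximalAtlas hψmax).mono fun z hz ↦ (htgt z hz).1
    have h2 : ContMDiffOn (𝓡 4) 𝓘(ℝ, Fin 2 → ℂ) ∞ (fun z ↦ β.symm (ψ z)) E.target :=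
      (contMDiffOn_iff_contDiffOn.2 hβ').comp h1 fun z hz ↦ (htgt z hz).2.1
    have h3 : ContMDiffOn (𝓡 4) 𝓘(ℝ, Fin 2 → ℂ) ∞ (fun z ↦ Φ.symm (β.symm (ψ z))) E.target :=
      (contMDiffOn_symm_of_mem_maximalAtlas hΦmax).comp h2 fun z hz ↦ (htgt z hz).2.2
    exact h3.congr fun z _ ↦ rfl
  exact ⟨⟨E.toPartialEquiv, E.open_source, E.open_target, hEsmooth, hEsymm⟩, hyE,
    fun x hx ↦ (hEq x hx).symm⟩

/-- **The projection is a branched double quotient** (`IsBranchedDoubleQuotient`): quotient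
map with fibres the orbits, `C^∞`, local diffeomorphism off the real locus, and at a real
point `x` the adapted chart `Φ ∋ x` of the atlas and its descended chart `ψ_Φ` exhibit the
projection as the model. [folklore] -/
theorem isBranchedDoubleQuotient [IsManifold 𝓘(ℝ, Fin 2 → ℂ) ∞ X] :
    letI := A.chartedSpace hs hσ hσc
    IsBranchedDoubleQuotient σ (Quotient.mk s) := by
  letI := A.chartedSpace hs hσ hσc
  haveI := A.isManifold hs hσ hσc
  refine ⟨isQuotientMap_mk, fun x y ↦ mk_eq_mk_iff hs x y, A.contMDiff_mk hs hσ hσc,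
    fun x hx ↦ A.isLocalDiffeomorphAt_mk hs hσ hσc hx, fun x _ ↦ ?_⟩
  obtain ⟨Φ, hΦ, hxΦ⟩ := A.covers x
  refine ⟨Φ, A.mem_maximalAtlas Φ hΦ, A.qchart hs hσ hσc hΦ,
    IsManifold.subset_maximalAtlas ⟨Φ, hΦ, rfl⟩, hxΦ, fun y hy ↦ ?_⟩
  exact ⟨A.mapsTo Φ hΦ hy, A.adapted Φ hΦ y hy, mk_mem_quotientChart_source hy,
    quotientChart_apply_mk hy⟩

/-- **Existence of the smooth branched double quotient from an adapted atlas**: for `X`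
compact, Hausdorff, second countable, the orbit space of `σ` with the charted space structure
of an adapted atlas is a compact Hausdorff second-countable `C^∞` `4`-manifold and the
projection is a branched double quotient. [folklore] -/
theorem exists_isBranchedDoubleQuotient [T2Space X] [SecondCountableTopology X] [CompactSpace X]
    [IsManifold 𝓘(ℝ, Fin 2 → ℂ) ∞ X] {σ : X → X} (hσ : Involutive σ) (hσc : Continuous σ)
    (A : AdaptedAtlas σ) :
    ∃ (Y : Type u) (_ : TopologicalSpace Y) (_ : T2Space Y) (_ : SecondCountableTopology Y)
      (_ : CompactSpace Y) (_ : ChartedSpace (EuclideanSpace ℝ (Fin 4)) Y)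
      (_ : IsManifold (𝓡 4) ∞ Y) (q : X → Y), IsBranchedDoubleQuotient σ q := by
  let s : Setoid X := ⟨fun x y ↦ y = x ∨ y = σ x, equivalence_orbitRel hσ⟩
  have hs : ∀ x y, s x y ↔ y = x ∨ y = σ x := fun _ _ ↦ Iff.rfl
  exact ⟨Quotient s, inferInstance, t2Space_quotient hs hσ hσc,
    secondCountableTopology_quotient hs hσ hσc, inferInstance,
    A.chartedSpace hs hσ hσc, A.isManifold hs hσ hσc, Quotient.mk s,
    A.isBranchedDoubleQuotient hs hσ hσc⟩

end AdaptedAtlas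

end Atlas

end ConjQuotient

end Literature.Topology.FourManifolds

end
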